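import Literature.NumberTheory.LFunctions.WeilTwoPrimeDeflL2Base
import Literature.NumberTheory.LFunctions.WeilBlockRowsPZ
import HarnessLib

/-!
# Deflated two-prime certificate L2: the factored even inverse agrees with `D`, rows 64–71

`WeilCert.checkDnRow` (even block) for certificate L2, by `decide +kernel`. Pure proof file.
-/

noncomputable section

namespace Literature.NumberTheory.LFunctions

set_option maxHeartbeats 0 in
/-- Row 64 of `DnE/LsE` is row 64 of the even `D` (certificate L2). [folklore] -/
theorem checkDnRow0_64_weilCertDeflL2 : weilCertDeflL2Base.checkDnRow weilCertDeflL2DnE weilCertDeflL2LsE 0 64 = true := by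
  decide +kernel

set_option maxHeartbeats 0 in
/-- Row 65 of `DnE/LsE` is row 65 of the even `D` (certificate L2). [folklore] -/
theorem checkDnRow0_65_weilCertDeflL2 : weilCertDeflL2Base.checkDnRow weilCertDeflL2DnE weilCertDeflL2LsE 0 65 = true := by
  decide +kernel

set_option maxHeartbeats 0 in
/-- Row 66 of `DnE/LsE` is row 66 of the even `D` (certificate L2). [folklore] -/
theorem checkDnRow0_66_weilCertDeflL2 : weilCertDeflL2Base.checkDnRow weilCertDeflL2DnE weilCertDeflL2LsE 0 66 = true := by
  decide +kernel

set_option maxHeartbeats 0 in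
/-- Row 67 of `DnE/LsE` is row 67 of the even `D` (certificate L2). [folklore] -/
theorem checkDnRow0_67_weilCertDeflL2 : weilCertDeflL2Base.checkDnRow weilCertDeflL2DnE weilCertDeflL2LsE 0 67 = true := by
  decide +kernel

set_option maxHeartbeats 0 in
/-- Row 68 of `DnE/LsE` is row 68 of the even `D` (certificate L2). [folklore] -/
theorem checkDnRow0_68_weilCertDeflL2 : weilCertDeflL2Base.checkDnRow weilCertDeflL2DnE weilCertDeflL2LsE 0 68 = true := by
  decide +kernel

set_option maxHeartbeats 0 in
/-- Row 69 of `DnE/LsE` is row 69 of the even `D` (certificate L2). [folklore] -/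
theorem checkDnRow0_69_weilCertDeflL2 : weilCertDeflL2Base.checkDnRow weilCertDeflL2DnE weilCertDeflL2LsE 0 69 = true := by
  decide +kernel

set_option maxHeartbeats 0 in
/-- Row 70 of `DnE/LsE` is row 70 of the even `D` (certificate L2). [folklore] -/
theorem checkDnRow0_70_weilCertDeflL2 : weilCertDeflL2Base.checkDnRow weilCertDeflL2DnE weilCertDeflL2LsE 0 70 = true := by
  decide +kernel

set_option maxHeartbeats 0 in
/-- Row 71 of `DnE/LsE` is row 71 of the even `D` (certificate L2). [folklore] -/
theorem checkDnRow0_71_weilCertDeflL2 : weilCertDeflL2Base.checkDnRow weilCertDeflL2DnE weilCertDeflL2LsE 0 71 = true := by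
  decide +kernel


end Literature.NumberTheory.LFunctions
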